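/-
Copyright (c) 2026 the pub-hodgecm-mathlib formalisation cell (harness21).  Prover seat hodgecm-mathlib-K2E3-p06 (g6) (E3 hand lent to L1; desk K2E3-p14 (g9) GO 2026-09-05T00:10:02Z
«B2a-inst `Theorems/K2LiuCMRankOneFrameOfRecord.lean`: the CM INSTANTIATION ∃-PACKAGE of ★ p862989's frame∕coordinate∕conductor letters — ONE `obtain` feeding ★ TailGlue
(K2Liu-p13), the `hN₃` producer FILE B (LH7-p06), «localFace» (LH4-p07) and LEVEL 2»), Track B «K2-LIT» ∕ hLiu418 = stmt-HodgeConjecture-24832: U1-CT-ind stage 3.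
THEOREMS ONLY (no `def`∕`instance`∕notation∕`sorry`).
-/
import Summits.HodgeConjecture.HodgeConjecture.Theorems.K2LiuSingularWhittakerTailGlue     -- ★ p863392∕p863438 (K2Liu-p13): THE CONSUMER's binder types; brings ★ p862989, ★ `exists_adaptedFrame_eq`, ★ `exists_homeomorph_coordTwo`, ★ B1 `unipDeltaLoc_eq_unipDeltaLocal`
import Summits.HodgeConjecture.HodgeConjecture.Theorems.K2LiuIsStdPlaceAdapted             -- ★ (E10a) `exists_isStd_placeAdapted` (+ ★ K2Lit `mem_siegelDeltaLoc_iff_local`)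
import Literature.NumberTheory.Automorphic.HeckeCharacterLocalComponentSmooth              -- ★ `HeckeCharacter.continuous_localComponent`
import HarnessLib

/-!
# Crux `HLiu418`, organ U1-CT-ind STAGE 3 («U1-glob»), B2a-inst: THE CM INSTANTIATION PACKAGE OF ★ p862989's FRAME ∕ COORDINATE ∕ CONDUCTOR LETTERS —
# at `(F, E, c, δ, T₂, J₂D) := (L⁺, L, complexConj, imagUnit L, gramR, hermD)`, `n = 2`: `∃ D Dinv Q e3 hDD hQm hQ, Dinv·D = 1 ∧ Dinv = 2·W·gramR ∧ he3 ∧ he3mul`, the `v₀`-adapted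
# compact `K₀` (`hK₀`, `hIw`, `ι_{v₀}(K₀) ⊆ 𝒦⁺.K`), and the conductor letter `∃ c_ν, hνc` of `χ_{F,v₀}` [HarrisKudlaSweet1996 §1 (1.11)–(1.15); Tan1999 §1; Tate1950 §2.3]

Cell `hodgecm-mathlib`, crux item hLiu418 = `stmt-HodgeConjecture-24832`; squad K2, strike line L1; desk K2E3-p14 (g9) + K2Liu-p13 (g4); prover K2E3-p06 (g6).
Lane `--supports stmt-HodgeConjecture-24832 --as helper` (count-neutral).

THE POINT.  ★ p862989 (`K2LiuSingularWhittakerLocalReading.exists_twoStep_reading_of_forall_eq`, LH7-p06 (g2)) and everything downstream of it at the CM datum — ★ TailGlue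
`exists_twoStep_reading_unipDeltaLoc_cm` ∕ `exists_localFactor_reading_of_hchar` ∕ `hchar_corner_of_record` (K2Liu-p13 (g4)), the `hN₃` producer FILE B `K2LiuLocalKernelN3Reading`
(LH7-p06), «localFace» (LH4-p07), U1-glob LEVEL 2 (K2E3-p14) — take the SAME letters at a finite place `v₀` of `L⁺`: the A7 frame `(D, Dinv, Q)` with `hDD hDD' hQm hQ` and (for the
corner dictionary) `hDinv : Dinv = 2·W·gramR`; the unipotent coordinates `e3 : L⁺_{v₀} × (L ⊗ L⁺_{v₀}) × L⁺_{v₀} ≃ₜ N_Δ(L⁺_{v₀})` with `he3` (through `frameConj Q ∘ nSiegel`) and `he3mul`;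
a compact open `K₀ ≤ H(L⁺_{v₀})` with the local Iwasawa decomposition `hIw` and `ι_{v₀}(K₀) ⊆ 𝒦⁺.K` (flatness of standard families); and the conductor letter `(c_ν, hνc)` of
`χ_{F,v₀} = chiF χ_v`.  Each exists by a ★ supplier; THIS FILE instantiates them ONCE, in the consumers' binder types TOKEN FOR TOKEN, so that every consumer opens ONE `obtain`:
* §1 (any local field ∕ any `E∕F`) `exists_conductor_letter` (a continuous character has a conductor letter, ★ `QuasiChar.exists_hasConductorExp`), `continuous_chiF`
  (★ `HeckeCharacter.continuous_localComponent`-ready: `χ_{F,v} = Π_w χ_w ∘ ι_w` is continuous when the `χ_w` are), `exists_homeomorph_coordTwo_of_eq` (★ `exists_homeomorph_coordTwo`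
  for ANY subgroup `N' = unipDeltaLocal`, the ★ TailGlue §1 generalisation trick);
* §2 (the CM datum) **`exists_cmFrame_coordTwo`** (`∃ D Dinv Q e3 (hDD) (hQm) (hQ), hDD' ∧ hDinv ∧ he3 ∧ he3mul` — ★ `exists_adaptedFrame_eq` at `(L⁺, 2, gramR)` + §1 along ★ B1
  `unipDeltaLoc_eq_unipDeltaLocal`), **`exists_placeAdapted_compact_cm`** (★ (E10a) in ★ p862989's `(K₀, hK₀, hIw)` spelling + the two saturation clauses), and
  **`exists_conductor_letter_chiF_localComponent`** (`∃ c_ν, hνc` for `χ_v := (χ.localComponent w)_w`).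
References: [HarrisKudlaSweet1996] M. Harris, S. Kudla, W. J. Sweet, J. AMS 9 (1996), §1 (1.11)–(1.15); [Tan1999] V. Tan, §1; [Tate1950] J. Tate (1950), §2.3; [BushnellHenniart2006] §1.8;
[Weil1965] A. Weil, Acta Math. 113 (1965), §37.
HONEST LABEL.  Count-neutral helper: `HC_CM` is proved only modulo the 7 printed citations (2 remaining named inputs: hLiu418 = `stmt-HodgeConjecture-24832`,
h413 = `stmt-HodgeConjecture-24833`) until rung 0 closes; this file closes no socket (it discharges input letters of U1-glob's local producers at the CM datum).
-/

set_option autoImplicit false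
set_option linter.dupNamespace false -- the mandated namespace repeats `HodgeConjecture.HodgeConjecture`

noncomputable section

open scoped NNReal ENNReal
open NumberField IsDedekindDomain Matrix Topology
open Literature.NumberTheory.GaloisRepresentations Literature.NumberTheory.GaloisRepresentations.IsNonarchimedeanLocalField
open Literature.NumberTheory.Automorphic Literature.NumberTheory.Automorphic.UnitaryGroup
open Literature.NumberTheory.GelbartRogawski1991 Literature.NumberTheory.GelbartRogawski1991.GRConstruction
open Literature.NumberTheory.GelbartRogawski1991.AdaptedBlocks
open Literature.NumberTheory.GelbartRogawski1991.UnitaryDualPair Literature.NumberTheory.GelbartRogawski1991.UnitaryDualPair.LocalSplitting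
open Literature.NumberTheory.K2Lit Literature.NumberTheory.K2Lit.SiegelDoubled Literature.NumberTheory.K2Lit.LocalSiegelDoubled
open Summit.HodgeConjecture.HodgeConjecture.Cruxes.HLiu418.K2LiuLocalLFactorDefs
open Summit.HodgeConjecture.HodgeConjecture.Cruxes.HLiu418.K2LiuLocalSiegelIwasawaFrame
open Summit.HodgeConjecture.HodgeConjecture.Cruxes.HLiu418.K2LiuLocalSiegelIwasawa
open Summit.HodgeConjecture.HodgeConjecture.Cruxes.HLiu418.K2LiuDoubledUTwoTwoBorelFrame
open Summit.HodgeConjecture.HodgeConjecture.Cruxes.HLiu418.K2LiuDoubledUTwoTwoWeylCocycle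
open Summit.HodgeConjecture.HodgeConjecture.Cruxes.HLiu418.K2LiuDoubledUTwoTwoLevi
open Summit.HodgeConjecture.HodgeConjecture.Cruxes.HLiu418.K2LiuDoubledUTwoTwoFrameTransport
open Summit.HodgeConjecture.HodgeConjecture.Cruxes.HLiu418.K2LiuDoubledUTwoTwoUnipotentCoordinates
open Summit.HodgeConjecture.HodgeConjecture.Cruxes.HLiu418.K2LiuDoubledUTwoTwoUnipotentHaar (exists_homeomorph_coordTwo)
open Summit.HodgeConjecture.HodgeConjecture.Cruxes.HLiu418.K2LiuUnipDeltaRankOneCoordinates (conjLocal_coord)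
open Summit.HodgeConjecture.HodgeConjecture.Cruxes.HLiu418.K2LiuRankOneCornerCharacterReading (exists_adaptedFrame_eq)
open Summit.HodgeConjecture.HodgeConjecture.Cruxes.HLiu418.K2LiuSiegelUnipotentLocalDefs (unipDeltaLoc)
open Summit.HodgeConjecture.HodgeConjecture.Cruxes.HLiu418.K2LiuUnipDeltaLocBridge (unipDeltaLoc_eq_unipDeltaLocal)
open Summit.HodgeConjecture.HodgeConjecture.Cruxes.HLiu418.K2LiuIsStdPlaceAdapted (exists_isStd_placeAdapted)

namespace Summit.HodgeConjecture.HodgeConjecture.Cruxes.HLiu418.K2LiuCMRankOneFrameOfRecord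

/-! ## §1 Three supplier-side lemmas (generic) -/

section LocalField

variable {K : Type*} [Field K] [ValuativeRel K] [TopologicalSpace K] [IsNonarchimedeanLocalField K]

/-- **a continuous character of `Kˣ` has a conductor letter** in ★ W-FE-3's ∕ ★ p862989 FILE B's spelling: `∃ c_ν : ℤ, ∀ x, ‖x‖ = 1 → x − 1 ∈ 𝔭^{c_ν} → ν x = 1`
(★ `QuasiChar.exists_hasConductorExp`; `U^{c} = {‖x‖ = 1, ‖x − 1‖ ≤ q^{−c}}`). [cite: Tate1950, §2.3] [cite: BushnellHenniart2006, §1.8] -/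
theorem exists_conductor_letter (ν : Kˣ →* ℂˣ) (hν : Continuous ν) :
    ∃ cν : ℤ, ∀ x : Kˣ, normAbs K (x : K) = 1 → (x : K) - 1 ∈ primePowBall K cν → ν x = 1 := by
  obtain ⟨a, ha⟩ := QuasiChar.exists_hasConductorExp (⟨ν, hν⟩ : QuasiChar K)
  refine ⟨a, fun x hx1 hx => ha.1 x ⟨hx1, ?_⟩⟩
  have h := mem_primePowBall_iff.1 hx
  rwa [zpow_natCast] at h

end LocalField

section Quadratic

variable (F : Type) [Field F] [NumberField F] (E : Type) [Field E] [NumberField E] [Algebra F E] (v : HeightOneSpectrum (𝓞 F))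

/-- **`χ_{F,v} = Π_{w∣v} χ_w ∘ ι_w` is continuous** when every `χ_w` is (★ `continuous_toPlace`, Mathlib `Continuous.units_map`). [cite: HarrisKudlaSweet1996, §6 (6.14)] -/
theorem continuous_chiF (χv : ∀ w : PlacesOver E v, (w.1.adicCompletion E)ˣ →* ℂˣ) (hcont : ∀ w, Continuous (χv w)) :
    Continuous (chiF F E v χv) := by
  have hfun : (fun x => chiF F E v χv x) = fun x =>
      ∏ w : PlacesOver E v, χv w (Units.map (toPlace v w : v.adicCompletion F →* w.1.adicCompletion E) x) :=
    funext (chiF_apply F E v χv)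
  show Continuous fun x => chiF F E v χv x
  rw [hfun]
  exact continuous_finsetProd _ fun w _ => (hcont w).comp (Continuous.units_map _ (continuous_toPlace v w))

variable [Algebra.IsQuadraticExtension F E] (c : E ≃ₐ[F] E) {δ : E} (hcδ : c δ = -δ) (hδ : δ ≠ 0)
  {T₂ : Matrix (Fin 2) (Fin 2) F} {J₂D : Matrix (Fin (2 + 2)) (Fin (2 + 2)) E} (hJ₂D : J₂D = (gramD F 2 T₂).map (algebraMap F E))
  (D Dinv : Matrix (Fin 2) (Fin 2) F) (hDD : D * Dinv = 1) (hDD' : Dinv * D = 1) (Q : GL (Fin (2 + 2)) F)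
  (hQm : (Q : Matrix (Fin (2 + 2)) (Fin (2 + 2)) F) = Matrix.reindex (e₂ 2) (e₂ 2) (Matrix.fromBlocks 1 D 1 (-D)))
  (hQ : (Q : Matrix (Fin (2 + 2)) (Fin (2 + 2)) F)ᵀ * gramD F 2 T₂ * (Q : Matrix (Fin (2 + 2)) (Fin (2 + 2)) F) = (StdForm.antidiagonal (2 + 2)).over F)

include hcδ hδ hJ₂D hDD hDD' hQm in
/-- **★ `exists_homeomorph_coordTwo` FOR ANY SUBGROUP `N' = N_Δ(F_v)`** (the ★ TailGlue §1 generalisation trick, so that the K2Lit carrier `unipDeltaLoc` is served through ★ B1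
`unipDeltaLoc_eq_unipDeltaLocal` without transporting the homeomorphism by hand). [cite: HarrisKudlaSweet1996, §1 (1.11)–(1.12)] [cite: Weil1965, §37] -/
theorem exists_homeomorph_coordTwo_of_eq {N' : Subgroup (UnitaryGroup.localPi E c (2 + 2) J₂D v)} (hN' : N' = unipDeltaLocal F E c v 2 (JD := J₂D)) :
    ∃ e : (v.adicCompletion F × UnitaryGroup.LocalRing E v × v.adicCompletion F) ≃ₜ N',
      (∀ b₁ z b₂, ((e (b₁, z, b₂) : N') : UnitaryGroup.localPi E c (2 + 2) J₂D v) =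
        FrameTransport.frameConj F E c v (2 + 2) hJ₂D (antidiagonal_over_eq_map F E 2) Q hQ
          (toLocalFour F E c v (nSiegel (UnitaryGroup.LocalRing E v) (UnitaryGroup.conjLocal E c v) (UnitaryGroup.conjLocal_conjLocal c v hcδ hδ)
            (UnitaryGroup.toLocalRing E v b₁ * algebraMap E (UnitaryGroup.LocalRing E v) δ) z
            (UnitaryGroup.toLocalRing E v b₂ * algebraMap E (UnitaryGroup.LocalRing E v) δ)
            (conjLocal_coord F E c hcδ v b₁) (conjLocal_coord F E c hcδ v b₂)))) ∧
      (∀ p p', e (p + p') = e p * e p') := by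
  subst hN'
  exact exists_homeomorph_coordTwo F E c hcδ hδ v hJ₂D D Dinv hDD hDD' Q hQm hQ

end Quadratic

/-! ## §2 The CM datum `(L⁺, L, complexConj, imagUnit, gramR, hermD)`, `n = 2` -/

section CM

variable (L : Type) [Field L] [NumberField L] [IsCMField L] {N M : ℕ} (e : Fin N × Fin M ≃ Fin 2)
  (dV : Fin N → L) (hdV : ∀ i, IsCMField.complexConj L (dV i) = dV i) (hdV0 : ∀ i, dV i ≠ 0)
  (dW : Fin M → L) (hdW : ∀ i, IsCMField.complexConj L (dW i) = dW i) (hdW0 : ∀ i, dW i ≠ 0)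
  (v₀ : HeightOneSpectrum (𝓞 (Fp L)))

include hdV0 hdW0 in
set_option maxHeartbeats 400000 in -- MEASURED 2026-09-05 (the statement's `he3` clause at the K2Lit CM telescope, class of ★ TailGlue §4): 200 000 ✗ (`whnf` timeout), 400 000 ✓; structural `obtain`∕`exact` only
/-- **THE FRAME AND THE COORDINATES OF RECORD AT `v₀` (ONE `obtain`).**  At the CM datum of rank `2` (`gramR` symmetric with unit determinant — `dV i ≠ 0`, `dW i ≠ 0`) there are
the A7-adapted frame `(D, Dinv, Q)` — `D·Dinv = 1`, `Q = e₂∘(1 D; 1 −D)`, `Qᵀ·(gramR ⊕ −gramR)·Q = J₄`, `Dinv·D = 1`, **`Dinv = 2·W·gramR`** (`W = 1.submatrix Fin.rev id`; ★ TailGlue §4's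
`hDinv`) — and the unipotent coordinates `e3 : L⁺_{v₀} × (L ⊗ L⁺_{v₀}) × L⁺_{v₀} ≃ₜ unipDeltaLoc v₀` with `he3` (through `frameConj Q ∘ nSiegel(ι b₁·δ, z, ι b₂·δ)`, `δ = imagUnit L`)
and `he3mul` — in ★ TailGlue's binder types token for token (`hDD hQm hQ` are bound as proofs, so `he3` names this `hQ`).  Use:
`obtain ⟨D, Dinv, Q, e3, hDD, hQm, hQ, hDD', hDinv, he3, he3mul⟩ := exists_cmFrame_coordTwo L e dV hdV hdV0 dW hdW hdW0 v₀`.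
(★ `exists_adaptedFrame_eq` at `(L⁺, 2, gramR)`; §1 `exists_homeomorph_coordTwo_of_eq` along ★ B1 `unipDeltaLoc_eq_unipDeltaLocal`.) [cite: HarrisKudlaSweet1996, §1 (1.11)–(1.12)] [cite: Weil1965, §37] -/
theorem exists_cmFrame_coordTwo :
    haveI : Algebra.IsQuadraticExtension (Fp L) L := IsCMField.isQuadraticExtension L
    ∃ (D Dinv : Matrix (Fin 2) (Fin 2) (Fp L)) (Q : GL (Fin (2 + 2)) (Fp L))
      (e3 : (v₀.adicCompletion (Fp L) × UnitaryGroup.LocalRing L v₀ × v₀.adicCompletion (Fp L)) ≃ₜ unipDeltaLoc L e dV hdV dW hdW v₀)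
      (_hDD : D * Dinv = 1)
      (_hQm : (Q : Matrix (Fin (2 + 2)) (Fin (2 + 2)) (Fp L)) = Matrix.reindex (e₂ 2) (e₂ 2) (Matrix.fromBlocks 1 D 1 (-D)))
      (hQ : (Q : Matrix (Fin (2 + 2)) (Fin (2 + 2)) (Fp L))ᵀ * gramD (Fp L) 2 (gramR L e dV hdV dW hdW) * (Q : Matrix (Fin (2 + 2)) (Fin (2 + 2)) (Fp L)) =
        (StdForm.antidiagonal (2 + 2)).over (Fp L)),
      Dinv * D = 1 ∧
      Dinv = (2 : Fp L) • ((1 : Matrix (Fin 2) (Fin 2) (Fp L)).submatrix Fin.rev id * gramR L e dV hdV dW hdW) ∧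
      (∀ b₁ z b₂, ((e3 (b₁, z, b₂) : unipDeltaLoc L e dV hdV dW hdW v₀) : UnitaryGroup.localPi L (IsCMField.complexConj L) (2 + 2) (hermD L e dV hdV dW hdW) v₀) =
        FrameTransport.frameConj (Fp L) L (IsCMField.complexConj L) v₀ (2 + 2) (hermD_eq_map_gramD L e dV hdV dW hdW) (antidiagonal_over_eq_map (Fp L) L 2) Q hQ
          (toLocalFour (Fp L) L (IsCMField.complexConj L) v₀ (nSiegel (UnitaryGroup.LocalRing L v₀) (UnitaryGroup.conjLocal L (IsCMField.complexConj L) v₀)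
            (UnitaryGroup.conjLocal_conjLocal (IsCMField.complexConj L) v₀ (complexConj_imagUnit L) (imagUnit_ne_zero L))
            (UnitaryGroup.toLocalRing L v₀ b₁ * algebraMap L (UnitaryGroup.LocalRing L v₀) (imagUnit L)) z
            (UnitaryGroup.toLocalRing L v₀ b₂ * algebraMap L (UnitaryGroup.LocalRing L v₀) (imagUnit L))
            (conjLocal_coord (Fp L) L (IsCMField.complexConj L) (complexConj_imagUnit L) v₀ b₁) (conjLocal_coord (Fp L) L (IsCMField.complexConj L) (complexConj_imagUnit L) v₀ b₂)))) ∧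
      (∀ p p', e3 (p + p') = e3 p * e3 p') := by
  haveI : Algebra.IsQuadraticExtension (Fp L) L := IsCMField.isQuadraticExtension L
  obtain ⟨D, Dinv, Q, hDD, hDD', hQm, hQ, -, hDinv⟩ :=
    exists_adaptedFrame_eq (Fp L) 2 (gramR_isSymm L e dV hdV dW hdW) (isUnit_det_gramR₀ L e dV hdV hdV0 dW hdW hdW0)
  obtain ⟨e3, he3, he3mul⟩ := exists_homeomorph_coordTwo_of_eq (Fp L) L v₀ (IsCMField.complexConj L) (complexConj_imagUnit L) (imagUnit_ne_zero L)
    (hermD_eq_map_gramD L e dV hdV dW hdW) D Dinv hDD hDD' Q hQm hQ (unipDeltaLoc_eq_unipDeltaLocal L e dV hdV dW hdW v₀)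
  exact ⟨D, Dinv, Q, e3, hDD, hQm, hQ, hDD', hDinv, he3, he3mul⟩

/-- **THE `v₀`-ADAPTED COMPACT (★ (E10a) in ★ p862989's spelling).**  For a standard Iwasawa datum `𝒦` there are a standard `𝒦⁺ ≥ 𝒦` and a compact open `K₀ ≤ H(L⁺_{v₀})` with the
LOCAL IWASAWA DECOMPOSITION in the `IsSiegelDelta`-spelling of ★ p862989 ∕ ★ TailGlue's `hIw` (★ K2Lit `mem_siegelDeltaLoc_iff_local`), `ι_{v₀}(K₀) ⊆ 𝒦⁺.K` (what ★ FILE 3 (iv) ∕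
`heightTwistLoc_flat` need for `hflat`) and `(k_f)_{v₀} ∈ K₀` for `k ∈ 𝒦⁺.K`. [cite: Tan1999, §1 p. 166] [cite: HarrisKudlaSweet1996, §1 (1.15)] [cite: BorelJacquet1979, §4.1] -/
theorem exists_placeAdapted_compact_cm {𝒦 : IwasawaDatum L e dV hdV dW hdW} (h𝒦 : 𝒦.IsStd) :
    haveI : Algebra.IsQuadraticExtension (Fp L) L := IsCMField.isQuadraticExtension L
    ∃ (𝒦' : IwasawaDatum L e dV hdV dW hdW) (K₀ : Subgroup (UnitaryGroup.localPi L (IsCMField.complexConj L) (2 + 2) (hermD L e dV hdV dW hdW) v₀)),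
      𝒦'.IsStd ∧ 𝒦.K ≤ 𝒦'.K ∧
      (IsCompact (K₀ : Set (UnitaryGroup.localPi L (IsCMField.complexConj L) (2 + 2) (hermD L e dV hdV dW hdW) v₀)) ∧
        IsOpen (K₀ : Set (UnitaryGroup.localPi L (IsCMField.complexConj L) (2 + 2) (hermD L e dV hdV dW hdW) v₀))) ∧
      (∀ g : UnitaryGroup.localPi L (IsCMField.complexConj L) (2 + 2) (hermD L e dV hdV dW hdW) v₀,
        ∃ p, IsSiegelDelta (Fp L) L (IsCMField.complexConj L) (complexConj_imagUnit L) (imagUnit_ne_zero L) (imagUnit_mul_self L) v₀ 2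
          (gramR_isSymm L e dV hdV dW hdW) (hermD_eq_map_gramD L e dV hdV dW hdW) p ∧ ∃ k ∈ K₀, g = p * k) ∧
      (∀ u ∈ K₀, locToAdelic L e dV hdV dW hdW v₀ u ∈ 𝒦'.K) ∧
      (∀ k : HA L e dV hdV dW hdW, k ∈ 𝒦'.K →
        UnitaryGroup.evalPlace (Fp L) L (IsCMField.complexConj L) (2 + 2) (hermD L e dV hdV dW hdW) v₀
          (UnitaryGroup.finPart (Fp L) L (IsCMField.complexConj L) (2 + 2) (hermD L e dV hdV dW hdW) k) ∈ K₀) := by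
  haveI : Algebra.IsQuadraticExtension (Fp L) L := IsCMField.isQuadraticExtension L
  obtain ⟨𝒦', K₀, -, hstd, hle, -, hcpt, hopen, hIw, hsat, hev⟩ := exists_isStd_placeAdapted (𝒦 := 𝒦) h𝒦 v₀
  refine ⟨𝒦', K₀, hstd, hle, ⟨hcpt, hopen⟩, fun g => ?_, hsat, hev⟩
  obtain ⟨p, hp, k, hk, hg⟩ := hIw g
  exact ⟨p, (mem_siegelDeltaLoc_iff_local L e dV hdV dW hdW v₀ p).1 hp, k, hk, hg⟩

omit [IsCMField L] in
/-- **THE CONDUCTOR LETTER OF `χ_{F,v₀}` FOR LOCAL COMPONENTS OF A HECKE CHARACTER** (`χ_v := (χ.localComponent w)_{w ∣ v₀}`): `∃ c_ν : ℤ, ∀ x, ‖x‖ = 1 → x − 1 ∈ 𝔭^{c_ν} →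
χ_{F,v₀}(x) = 1` — ★ p862989 FILE B's `(cν, hνc)` and ★ W-FE-3∕W-FE-4's conductor letter (★ `HeckeCharacter.continuous_localComponent`, §1). [cite: Tate1950, §2.3] [cite: TateThesis1967, §4.3] -/
theorem exists_conductor_letter_chiF_localComponent {F' : Type} [Field F'] [NumberField F'] [Algebra F' L] (χ : HeckeCharacter L) (v : HeightOneSpectrum (𝓞 F')) :
    ∃ cν : ℤ, ∀ x : (v.adicCompletion F')ˣ, normAbs (v.adicCompletion F') (x : v.adicCompletion F') = 1 →
      (x : v.adicCompletion F') - 1 ∈ primePowBall (v.adicCompletion F') cν → chiF F' L v (fun w => χ.localComponent w.1) x = 1 :=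
  exists_conductor_letter _ (continuous_chiF F' L v (fun w => χ.localComponent w.1) fun w => HeckeCharacter.continuous_localComponent χ w.1)

end CM

end Summit.HodgeConjecture.HodgeConjecture.Cruxes.HLiu418.K2LiuCMRankOneFrameOfRecord

end
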